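import Summits.QuantumFields.YangMills.Theses.DoublingDefect

/-!
# Birth skeleton (BC3) for crux `DoublingRecursion` (stmt-QuantumFields-17754) — `Lines/birth.lean`

Registrar: `planner-skel-stmt-QuantumFields-17754-0` (skeleton-register one-shot; route
`route-QuantumFields-DoublingDefect`, sub-problem `YangMills`, re-audit bin HONEST), 2026-08-17.

Crux (route file `Theses/DoublingDefect.lean`, decl
`Summit.QuantumFields.YangMills.Theses.DoublingDefect.DoublingRecursion`, rank 3): for every
simply-connected compact simple `G` and faithful unitary `r` there are `C > 0`, `β₀`, `L₀` with
`δ_β(L') ≤ C · δ_β(L)²` for all `β ≥ β₀`, `L ≥ L₀`, `L' ∈ [2L, 4L]`, where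
`δ_β(L) = 1 - Z_β(L,L,L,2L) / Z_β(L,L,L,L)²` is the period-doubling (purity) defect of Wilson's
theory in the representation `r` on the anisotropic four-torus (the route's inline `Z`).

## The cut: EQUAL-TEMPERATURE SPATIAL COMPARISON ⊕ TEMPORAL SQUARING ⊕ COOLING

Write `d_β(a,t) := 1 - Z_β(a,a,a,2t) / Z_β(a,a,a,t)²` for the two-period purity defect of the
spatial torus `a³` at inverse temperature `t` (so `δ_β(L) = d_β(L,L)`).  By Lüscher's transfer
matrix (`Z_β(a,a,a,t) = Tr T_a^t` exactly for `t ≥ 1`, `T_a ≥ 0` self-adjoint and trace class for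
`β ≥ 0`, because `g ↦ exp(β Re tr ρ(g))` is of positive type — the refuter's normalisation check on
this item, 2026-08-17), `1 - d_β(a,t) = ∑ᵢ pᵢ(t)²` is the PURITY of the Gibbs weights
`pᵢ(t) = λᵢ^t / ∑ⱼ λⱼ^t` of the spectrum of `T_a`.  The crux mixes two moves — enlarging the
SPATIAL box `L ↦ L'` and lowering the TEMPERATURE `1/L ↦ 1/L'` — whose mechanisms are different;
the skeleton separates them:

* `stub_defectMonotone` (TM, transfer-matrix spectral fact, size M): for `β ≥ 0`, `a, t ≥ 1`,
  `0 ≤ d_β(a,t') ≤ d_β(a,t)` whenever `t ≤ t'` — purity of a Gibbs state is at most `1` and does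
  not decrease on cooling (`t ↦ log Z(a,t)` is convex by Cauchy–Schwarz on `∑ λᵢ^t`, `λᵢ ≥ 0`).
  Stated for EVERY compact `G` with a unitary lattice representation (it is structural).
  Leans on: Lüscher 1977 / Osterwalder–Seiler 1978 (transfer matrix, not yet a tree object).
* `stub_temporalSquaring` (TS, transfer-matrix spectral fact, size M): for `β ≥ 0`, `a, t ≥ 1`,
  `d_β(a,2t) · (1 - d_β(a,t))² ≤ d_β(a,t)²` — HALVING THE TEMPERATURE SQUARES THE DEFECT: with
  `qᵢ = pᵢ(t)`, `d(2t)·(∑qᵢ²)² = ∑_{i≠j} qᵢ²qⱼ² ≤ (∑_{i≠j} qᵢqⱼ)² = d(t)²`.  This is the rigorous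
  core of the 2001 "time-shifted" recursion W″; it is free of physics.  Same generality as TM.
* `stub_spatialComparison` (SS, the OPEN physics, size L–XL): for simply-connected compact simple
  `G` and faithful `r` there are `K ≥ 0`, `β₀`, `L₀` with `d_β(L',L) ≤ K · d_β(L,L) = K · δ_β(L)`
  for `β ≥ β₀`, `L ≥ L₀`, `L' ∈ [2L,4L]` — AT EQUAL TEMPERATURE `1/L`, enlarging the spatial torus
  `2–4×` costs at most a constant factor in the defect (no light states that fit only the bigger
  box: flux/torelon energies grow like `σ·a`, glueball momentum modes contribute `≲ (L'/L)³`,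
  finite-size mass shifts `e^{L Δm}` are `O(1)` where `mL = O(1)` and exponentially small beyond).
  It carries verbatim the crux's "why it might fail" (a torus gap collapsing under spatial
  doubling in the crossover `L ~ ξ(β)`); it is LINEAR and compares DIFFERENT boxes at the SAME
  temperature, so it is neither the crux (quadratic, different temperatures) nor implied by it.
* `DoublingRecursion_of : TM-sig → TS-sig → SS-sig → DoublingRecursion` — sorry-free, pure algebra
  (`defect_arith`): with `x = δ(L)`, `y = d(L',L)`, `z = d(L',2L)`, `w = δ(L') = d(L',L')`:
  SS gives `0 ≤ y ≤ Kx`, TS gives `z(1-y)² ≤ y²`, TM gives `0 ≤ z ≤ y` and `w ≤ z` (`2L ≤ L'`);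
  if `y ≤ ½` then `w ≤ z ≤ 4y² ≤ 4K²x²`, else `(K+1)x > ½` and `w ≤ y ≤ (K+1)x < 4(K+1)²x²`.
  Constants: `C = 4(K+1)²`, `β₀ ↦ max β₀ 0`, `L₀ ↦ max L₀ 1`.  `DoublingRecursion_skeleton`
  instantiates it with the three stubs BY NAME.

Disproof used: none on file for this crux (`ledger crux ls stmt-QuantumFields-17754`: no workfiles
before this one; no `Disproof.lean`).  The refuter's crux-attack at birth (item note
2026-08-17T05:11Z, SURVIVES) verified the normalisation `Z(a,t) = Tr T_a^t`, `T_a ≥ 0`, `0 ≤ δ < 1`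
for `β ≥ 0`, `L ≥ 1` — exactly the input of TM/TS — and found no finite counterexample family; the
negatives index of the summit has no statement about `Z`-ratios / purity defects.  No stub is an
instance of a landed Negative lemma (there is none under `Theorems/DoublingRecursion/`).

BC3 probes (registrar folder `bc/probe_*.lean`, outputs quoted in `Lines/birth.md` / NOTES):
`stub → DoublingRecursion` and `stub → YangMills` by `first | exact? | simpa | aesop` FAIL for all
three stubs.  `lean check`: rc 0; sorries = 3 = stubs (`stub_defectMonotone`,
`stub_temporalSquaring`, `stub_spatialComparison`), zero elsewhere.
Namespace `Summit.QuantumFields.YangMills.Cruxes.DoublingRecursion.Birth`.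
-/

set_option autoImplicit false

noncomputable section

namespace Summit.QuantumFields.YangMills.Cruxes.DoublingRecursion.Birth

open scoped BigOperators Topology Manifold Classical MeasureTheory ProbabilityTheory Matrix InnerProductSpace ComplexConjugate ContinuousMap
open Filter Set Function TopologicalSpace MeasureTheory
open Summit.QuantumFields.YangMills.Theses.DoublingDefect (DoublingRecursion)

/-! ## § Stubs — the ONLY three `sorry`s of the file -/

/-- **Stub 1 `stub_defectMonotone` (TM) — the two-period purity defect is non-negative and does not
increase on cooling.**  For every compact group `G` with a continuous unitary lattice representation
`r`, every `β ≥ 0`, every spatial side `a ≥ 1` and inverse temperatures `1 ≤ t ≤ t'`: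
`0 ≤ d_β(a,t') ≤ d_β(a,t)`, `d_β(a,t) := 1 - Z_β(a,a,a,2t)/Z_β(a,a,a,t)²` (`Z` = the route's inline
anisotropic-torus Wilson partition function, verbatim).  Mechanism: `Z_β(a,a,a,t) = Tr T_a^t` with
`T_a ≥ 0` trace class (Lüscher 1977; positive type of `exp(β Re tr ρ)` for `β ≥ 0`), so
`Z(2t) ≤ Z(t)²` and `t ↦ log Z(t)` is convex on the integers (Cauchy–Schwarz), which is the
monotonicity of `Z(2t)/Z(t)²`.  Size M (the transfer matrix of this inline `Z` is not a tree object). -/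
theorem stub_defectMonotone :
    ∀ (G : Type) [Group G] [TopologicalSpace G] [IsTopologicalGroup G] [CompactSpace G] [MeasurableSpace G] [BorelSpace G] (r : Literature.MathematicalPhysics.QuantumFieldTheory.LatticeRep G),
      let Z : ℝ → ℕ → ℕ → ℝ := fun β a t => let St := Fin a × Fin a × Fin a × Fin t; let sh : St → Fin 4 → St := fun x μ => ![(finRotate a x.1, x.2.1, x.2.2.1, x.2.2.2), (x.1, finRotate a x.2.1, x.2.2.1, x.2.2.2), (x.1, x.2.1, finRotate a x.2.2.1, x.2.2.2), (x.1, x.2.1, x.2.2.1, finRotate t x.2.2.2)] μ; let pl : (St × Fin 4 → G) → St → Fin 4 → Fin 4 → G := fun U x μ ν => U (x, μ) * U (sh x μ, ν) * (U (sh x ν, μ))⁻¹ * (U (x, ν))⁻¹; ∫ U, Real.exp (-β * ∑ x : St, ∑ q : {q : Fin 4 × Fin 4 // q.1 < q.2}, ((r.N : ℝ) - (r.ρ (pl U x q.1.1 q.1.2)).trace.re)) ∂(Measure.pi fun _ : St × Fin 4 => Literature.MathematicalPhysics.QuantumFieldTheory.haarProbability G);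
      let d : ℝ → ℕ → ℕ → ℝ := fun β a t => 1 - Z β a (2 * t) / (Z β a t) ^ 2;
      ∀ β : ℝ, 0 ≤ β → ∀ a t t' : ℕ, 1 ≤ a → 1 ≤ t → t ≤ t' → 0 ≤ d β a t' ∧ d β a t' ≤ d β a t := by
  sorry

/-- **Stub 2 `stub_temporalSquaring` (TS) — halving the temperature squares the defect.**  Same
generality: for `β ≥ 0`, `a ≥ 1`, `t ≥ 1`, `d_β(a,2t) · (1 - d_β(a,t))² ≤ d_β(a,t)²`.  Mechanism: with
the Gibbs weights `qᵢ = λᵢ^t/Z(t)` of `T_a`, `1 - d(t) = ∑ qᵢ²` and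
`d(2t) · (∑ qᵢ²)² = (∑ qᵢ²)² - ∑ qᵢ⁴ = ∑_{i≠j} qᵢ² qⱼ² ≤ (∑_{i≠j} qᵢ qⱼ)² = d(t)²` (all terms
non-negative).  The rigorous core of the 2001 time-shifted recursion W″.  Size M (same transfer-matrix
input as TM, then finite/ℓ¹ algebra). -/
theorem stub_temporalSquaring :
    ∀ (G : Type) [Group G] [TopologicalSpace G] [IsTopologicalGroup G] [CompactSpace G] [MeasurableSpace G] [BorelSpace G] (r : Literature.MathematicalPhysics.QuantumFieldTheory.LatticeRep G),
      let Z : ℝ → ℕ → ℕ → ℝ := fun β a t => let St := Fin a × Fin a × Fin a × Fin t; let sh : St → Fin 4 → St := fun x μ => ![(finRotate a x.1, x.2.1, x.2.2.1, x.2.2.2), (x.1, finRotate a x.2.1, x.2.2.1, x.2.2.2), (x.1, x.2.1, finRotate a x.2.2.1, x.2.2.2), (x.1, x.2.1, x.2.2.1, finRotate t x.2.2.2)] μ; let pl : (St × Fin 4 → G) → St → Fin 4 → Fin 4 → G := fun U x μ ν => U (x, μ) * U (sh x μ, ν) * (U (sh x ν, μ))⁻¹ * (U (x, ν))⁻¹;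 ∫ U, Real.exp (-β * ∑ x : St, ∑ q : {q : Fin 4 × Fin 4 // q.1 < q.2}, ((r.N : ℝ) - (r.ρ (pl U x q.1.1 q.1.2)).trace.re)) ∂(Measure.pi fun _ : St × Fin 4 => Literature.MathematicalPhysics.QuantumFieldTheory.haarProbability G);
      let d : ℝ → ℕ → ℕ → ℝ := fun β a t => 1 - Z β a (2 * t) / (Z β a t) ^ 2;
      ∀ β : ℝ, 0 ≤ β → ∀ a t : ℕ, 1 ≤ a → 1 ≤ t → d β a (2 * t) * (1 - d β a t) ^ 2 ≤ (d β a t) ^ 2 := by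
  sorry

/-- **Stub 3 `stub_spatialComparison` (SS) — the open core: at equal temperature, enlarging the
spatial torus costs a constant.**  For every simply-connected compact simple `G` and faithful unitary
`r` there are `K ≥ 0`, `β₀`, `L₀` such that for `β ≥ β₀`, `L ≥ L₀`, `L' ∈ [2L, 4L]`:
`d_β(L',L) ≤ K · d_β(L,L)` (`= K · δ_β(L)`): the `L'`-box at inverse temperature `L` is at most `K`
times less pure than the `L`-box at the same temperature.  Why plausibly true: the spectrum of
`T_{L'}` below any fixed energy is that of `T_L` up to (i) momentum refinements, `≲ (L'/L)³ ≤ 64`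
states per level, (ii) finite-size mass shifts `Δm` with `L·Δm = O(1)` in the femto/crossover regime
and `O(e^{-c m L})` beyond, (iii) flux/torelon energies, which GROW with the spatial side; in the
femto regime both sides are `O(1)` (`δ ≈ 1 - |Z(G)|⁻³`).  Why it might fail (= the crux's): light
states fitting only the bigger box in the crossover `L ~ ξ(β)`, uniformly in `β` — nobody controls
the crossover rigorously.  Size L–XL / open.  Strictly different from the crux (linear, equal
temperatures, two boxes) and not cheaply equivalent to it or to the summit (BC3 probes fail). -/
theorem stub_spatialComparison :
    ∀ (G : Type) [Group G] [TopologicalSpace G] [IsTopologicalGroup G] [CompactSpace G] [MeasurableSpace G] [BorelSpace G], Literature.MathematicalPhysics.QuantumFieldTheory.IsCompactSimpleLieGroup G → SimplyConnectedSpace G → ∀ r : Literature.MathematicalPhysics.QuantumFieldTheory.LatticeRep G,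
      let Z : ℝ → ℕ → ℕ → ℝ := fun β a t => let St := Fin a × Fin a × Fin a × Fin t; let sh : St → Fin 4 → St := fun x μ => ![(finRotate a x.1, x.2.1, x.2.2.1, x.2.2.2), (x.1, finRotate a x.2.1, x.2.2.1, x.2.2.2), (x.1, x.2.1, finRotate a x.2.2.1, x.2.2.2), (x.1, x.2.1, x.2.2.1, finRotate t x.2.2.2)] μ; let pl : (St × Fin 4 → G) → St → Fin 4 → Fin 4 → G := fun U x μ ν => U (x, μ) * U (sh x μ, ν) * (U (sh x ν, μ))⁻¹ * (U (x, ν))⁻¹; ∫ U, Real.exp (-β * ∑ x : St, ∑ q : {q : Fin 4 × Fin 4 // q.1 < q.2}, ((r.N : ℝ) - (r.ρ (pl U x q.1.1 q.1.2)).trace.re)) ∂(Measure.pi fun _ : St × Fin 4 => Literature.MathematicalPhysics.QuantumFieldTheory.haarProbability G);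
      let d : ℝ → ℕ → ℕ → ℝ := fun β a t => 1 - Z β a (2 * t) / (Z β a t) ^ 2;
      ∃ K β₀ : ℝ, ∃ L₀ : ℕ, 0 ≤ K ∧ ∀ β : ℝ, β₀ ≤ β → ∀ L : ℕ, L₀ ≤ L → ∀ L' : ℕ, 2 * L ≤ L' → L' ≤ 4 * L → d β L' L ≤ K * d β L L := by
  sorry

/-! ## § Glue — pure real arithmetic (sorry-free) -/

/-- The numerical heart of the composition: from `0 ≤ y ≤ K x` (spatial comparison),
`z (1 - y)² ≤ y²` (temporal squaring), `0 ≤ z ≤ y` and `w ≤ z` (monotonicity) conclude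
`w ≤ 4 (K+1)² x²` — case `y ≤ ½`: `w ≤ z ≤ 4 y² ≤ 4 K² x²`; case `y > ½`: `(K+1) x > ½`, so
`w ≤ y ≤ (K+1) x < 4 ((K+1) x)²`. -/
theorem defect_arith {K x y z w : ℝ} (hK : 0 ≤ K) (hx : 0 ≤ x) (hy : 0 ≤ y) (hyx : y ≤ K * x)
    (hz : 0 ≤ z) (hzy : z ≤ y) (hsq : z * (1 - y) ^ 2 ≤ y ^ 2) (hwz : w ≤ z) :
    w ≤ 4 * (K + 1) ^ 2 * x ^ 2 := by
  have hKx : K * x ≤ (K + 1) * x := by nlinarith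
  have hyu : y ≤ (K + 1) * x := le_trans hyx hKx
  rcases le_or_gt y (1 / 2) with h | h
  · have h1 : (1 : ℝ) / 4 ≤ (1 - y) ^ 2 := by nlinarith
    have h2 : z ≤ 4 * y ^ 2 := by nlinarith [mul_le_mul_of_nonneg_left h1 hz]
    have h3 : y ^ 2 ≤ ((K + 1) * x) ^ 2 := pow_le_pow_left₀ hy hyu 2
    nlinarith
  · have h1 : (1 : ℝ) / 2 < (K + 1) * x := lt_of_lt_of_le h hyu
    nlinarith

/-! ## § Assembly — sorry-free; concludes the route decl BY NAME -/

/-- **Composition (real proof).**  The three stub statements imply the crux `DoublingRecursion` BY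
NAME: take `K, β₀, L₀` from the spatial comparison; answer with `C = 4 (K+1)²`, `max β₀ 0`,
`max L₀ 1`; for `β ≥ max β₀ 0`, `L ≥ max L₀ 1`, `2L ≤ L' ≤ 4L` feed `defect_arith` with
`x = δ(L) = d(L,L)`, `y = d(L',L)`, `z = d(L',2L)`, `w = δ(L') = d(L',L')`: `0 ≤ x` (TM at
`(L,L,L)`), `0 ≤ y` (TM at `(L',L,L)`), `y ≤ K x` (SS), `0 ≤ z ≤ y` (TM at `(L',L,2L)`),
`z (1-y)² ≤ y²` (TS at `(L',L)`), `w ≤ z` (TM at `(L',2L,L')`).  The route's `let Z`/`let δ` and the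
stubs' `let Z`/`let d` are the same terms, matched definitionally. -/
theorem DoublingRecursion_of :
    (∀ (G : Type) [Group G] [TopologicalSpace G] [IsTopologicalGroup G] [CompactSpace G] [MeasurableSpace G] [BorelSpace G] (r : Literature.MathematicalPhysics.QuantumFieldTheory.LatticeRep G),
        let Z : ℝ → ℕ → ℕ → ℝ := fun β a t => let St := Fin a × Fin a × Fin a × Fin t; let sh : St → Fin 4 → St := fun x μ => ![(finRotate a x.1, x.2.1, x.2.2.1, x.2.2.2), (x.1, finRotate a x.2.1, x.2.2.1, x.2.2.2), (x.1, x.2.1, finRotate a x.2.2.1, x.2.2.2), (x.1, x.2.1, x.2.2.1, finRotate t x.2.2.2)] μ; let pl : (St × Fin 4 → G) → St → Fin 4 → Fin 4 → G := fun U x μ ν => U (x, μ) * U (sh x μ, ν) * (U (sh x ν, μ))⁻¹ * (U (x, ν))⁻¹; ∫ U, Real.exp (-β * ∑ x : St, ∑ q : {q : Fin 4 × Fin 4 // q.1 < q.2}, ((r.N : ℝ) - (r.ρ (pl U x q.1.1 q.1.2)).trace.re)) ∂(Measure.pi fun _ : St × Fin 4 => Literature.MathematicalPhysics.QuantumFieldTheory.haarProbability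 G);
        let d : ℝ → ℕ → ℕ → ℝ := fun β a t => 1 - Z β a (2 * t) / (Z β a t) ^ 2;
        ∀ β : ℝ, 0 ≤ β → ∀ a t t' : ℕ, 1 ≤ a → 1 ≤ t → t ≤ t' → 0 ≤ d β a t' ∧ d β a t' ≤ d β a t) →
    (∀ (G : Type) [Group G] [TopologicalSpace G] [IsTopologicalGroup G] [CompactSpace G] [MeasurableSpace G] [BorelSpace G] (r : Literature.MathematicalPhysics.QuantumFieldTheory.LatticeRep G),
        let Z : ℝ → ℕ → ℕ → ℝ := fun β a t => let St := Fin a × Fin a × Fin a × Fin t; let sh : St → Fin 4 → St := fun x μ => ![(finRotate a x.1, x.2.1, x.2.2.1, x.2.2.2), (x.1, finRotate a x.2.1, x.2.2.1, x.2.2.2), (x.1, x.2.1, finRotate a x.2.2.1, x.2.2.2), (x.1, x.2.1, x.2.2.1, finRotate t x.2.2.2)] μ; let pl : (St × Fin 4 → G) → St → Fin 4 → Fin 4 → G := fun U x μ ν => U (x, μ) * U (sh x μ, ν) * (U (sh x ν, μ))⁻¹ * (U (x, ν))⁻¹; ∫ U, Real.exp (-β * ∑ x : St, ∑ q : {q :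 Fin 4 × Fin 4 // q.1 < q.2}, ((r.N : ℝ) - (r.ρ (pl U x q.1.1 q.1.2)).trace.re)) ∂(Measure.pi fun _ : St × Fin 4 => Literature.MathematicalPhysics.QuantumFieldTheory.haarProbability G);
        let d : ℝ → ℕ → ℕ → ℝ := fun β a t => 1 - Z β a (2 * t) / (Z β a t) ^ 2;
        ∀ β : ℝ, 0 ≤ β → ∀ a t : ℕ, 1 ≤ a → 1 ≤ t → d β a (2 * t) * (1 - d β a t) ^ 2 ≤ (d β a t) ^ 2) →
    (∀ (G : Type) [Group G] [TopologicalSpace G] [IsTopologicalGroup G] [CompactSpace G] [MeasurableSpace G] [BorelSpace G], Literature.MathematicalPhysics.QuantumFieldTheory.IsCompactSimpleLieGroup G → SimplyConnectedSpace G → ∀ r : Literature.MathematicalPhysics.QuantumFieldTheory.LatticeRep G,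
        let Z : ℝ → ℕ → ℕ → ℝ := fun β a t => let St := Fin a × Fin a × Fin a × Fin t; let sh : St → Fin 4 → St := fun x μ => ![(finRotate a x.1, x.2.1, x.2.2.1, x.2.2.2), (x.1, finRotate a x.2.1, x.2.2.1, x.2.2.2), (x.1, x.2.1, finRotate a x.2.2.1, x.2.2.2), (x.1, x.2.1, x.2.2.1, finRotate t x.2.2.2)] μ; let pl : (St × Fin 4 → G) → St → Fin 4 → Fin 4 → G := fun U x μ ν => U (x, μ) * U (sh x μ, ν) * (U (sh x ν, μ))⁻¹ * (U (x, ν))⁻¹; ∫ U, Real.exp (-β * ∑ x : St, ∑ q : {q : Fin 4 × Fin 4 // q.1 < q.2}, ((r.N : ℝ) - (r.ρ (pl U x q.1.1 q.1.2)).trace.re)) ∂(Measure.pi fun _ : St × Fin 4 => Literature.MathematicalPhysics.QuantumFieldTheory.haarProbability G);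
        let d : ℝ → ℕ → ℕ → ℝ := fun β a t => 1 - Z β a (2 * t) / (Z β a t) ^ 2;
        ∃ K β₀ : ℝ, ∃ L₀ : ℕ, 0 ≤ K ∧ ∀ β : ℝ, β₀ ≤ β → ∀ L : ℕ, L₀ ≤ L → ∀ L' : ℕ, 2 * L ≤ L' → L' ≤ 4 * L → d β L' L ≤ K * d β L L) →
    DoublingRecursion := by
  intro hTM hTS hSS G i1 i2 i3 i4 i5 i6 hG hSC r Z δ
  obtain ⟨K, β₀, L₀, hK, hS⟩ := hSS G hG hSC r
  have hM := hTM G r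
  have hT := hTS G r
  refine ⟨4 * (K + 1) ^ 2, max β₀ 0, max L₀ 1, by positivity, ?_⟩
  intro β hβ L hL L' hL1 hL2
  have hβ0 : 0 ≤ β := le_trans (le_max_right _ _) hβ
  have hβ1 : β₀ ≤ β := le_trans (le_max_left _ _) hβ
  have hL₀ : L₀ ≤ L := le_trans (le_max_left _ _) hL
  have h1L : 1 ≤ L := le_trans (le_max_right _ _) hL
  have h1L' : 1 ≤ L' := by omega
  have h12L : 1 ≤ 2 * L := by omega
  have hL2L : L ≤ 2 * L := by omega
  -- the eight clean facts, written with the goal's let-bound `Z`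
  have hx : 0 ≤ 1 - Z β L (2 * L) / (Z β L L) ^ 2 := (hM β hβ0 L L L h1L h1L le_rfl).1
  have hy : 0 ≤ 1 - Z β L' (2 * L) / (Z β L' L) ^ 2 := (hM β hβ0 L' L L h1L' h1L le_rfl).1
  have hyx : 1 - Z β L' (2 * L) / (Z β L' L) ^ 2 ≤ K * (1 - Z β L (2 * L) / (Z β L L) ^ 2) :=
    hS β hβ1 L hL₀ L' hL1 hL2
  have hzz := hM β hβ0 L' L (2 * L) h1L' h1L hL2L
  have hz : 0 ≤ 1 - Z β L' (2 * (2 * L)) / (Z β L' (2 * L)) ^ 2 := hzz.1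
  have hzy : 1 - Z β L' (2 * (2 * L)) / (Z β L' (2 * L)) ^ 2 ≤ 1 - Z β L' (2 * L) / (Z β L' L) ^ 2 :=
    hzz.2
  have hsq : (1 - Z β L' (2 * (2 * L)) / (Z β L' (2 * L)) ^ 2) *
      (1 - (1 - Z β L' (2 * L) / (Z β L' L) ^ 2)) ^ 2 ≤ (1 - Z β L' (2 * L) / (Z β L' L) ^ 2) ^ 2 :=
    hT β hβ0 L' L h1L' h1L
  have hwz : 1 - Z β L' (2 * L') / (Z β L' L') ^ 2 ≤ 1 - Z β L' (2 * (2 * L)) / (Z β L' (2 * L)) ^ 2 :=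
    (hM β hβ0 L' (2 * L) L' h1L' h12L hL1).2
  show 1 - Z β L' (2 * L') / (Z β L' L') ^ 2 ≤ 4 * (K + 1) ^ 2 * (1 - Z β L (2 * L) / (Z β L L) ^ 2) ^ 2
  exact defect_arith hK hx hy hyx hz hzy hsq hwz

/-- The birth skeleton: the crux BY NAME modulo exactly the three registered stubs. -/
theorem DoublingRecursion_skeleton : DoublingRecursion :=
  DoublingRecursion_of stub_defectMonotone stub_temporalSquaring stub_spatialComparison

end Summit.QuantumFields.YangMills.Cruxes.DoublingRecursion.Birth
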